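import Summits.BirchSwinnertonDyer.BirchSwinnertonDyer.Theorems.QuadraticBranchSignedControlPlusKatoDivisibilityOfEulerSystemBound
import Literature.NumberTheory.EllipticCurves.Kato2004.FineSelmerDualTorsionOfEulerSystemBoundProofs
import Literature.NumberTheory.EllipticCurves.Kato2004.ConditionVOfNotHasCMProofs
import HarnessLib

/-!
# K8 crux 20445 `PlusKatoDivisibilityBranchOnto` — lane B hardening (g7): Kobayashi Cor. 7.2 at `η`
# («`X⁰(V/K_∞)^η = X₀(V^{(p*)}/ℚ_∞)` is `Λ`-torsion», the FIELD `isTorsion_fine` of the held package hZ)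
# is IDLE on every row where Kato's hypothesis (v) holds — it follows from the OTHER fields of hZ and
# Kato Thm. 13.4 (2) BY NAME; the package is rebuilt from its slim field set (proofs only)

Cell `bsd-potss` (HOME `run/shared/lean/pub/bsd-potss/`), seat `bsd-potss-k8q-c2x` g7 (prover; WIDTH-LEVER
lane B of the K8 Kato side, route `QuadraticBranchSignedControl`, crux stmt-BirchSwinnertonDyer-20445
split into the held aliases 21362 `PublishedInputKobZetaEtaOnto` = hZ =
`Kobayashi2003.thm62_63_73_etaColemanPoitouTate_zeta`, 21363 `PublishedInputKatoThm134Onto` = h134 =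
`Kato2004.thm13_4_lengthAt_fineSelmerDual_le_of_isEulerSystemClass`, 21364 = h12). HONEST FRAMING: the
programme assembles BSD for analytic rank `≤ 1` strictly from published theorems and TYPES the remainder;
BSD is not proved by any of this; every theorem below is CONDITIONAL on the named Literature fact(s)
displayed as hypotheses; the crux stays settled-by-citation; this file closes NOTHING and books nothing
(`--supports 20445 --as helper`). PARTITION (D-0054): EXCLUDED-DOMAIN non-CM ∪ CM additive `p` · B4 Gss2
(`e = 2`, `p ≥ 5`); reach of this file = the rows with (v) for `T_pW`, `W ≅ V^{(p*)}`: all tower-onto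
rows (the crux's domain) and all non-CM rows.

## What is proved

The held package hZ (`Kobayashi2003.EtaColemanPoitouTateZetaData`) has the fields `z`, `isTorsion_fine`
(Cor. 7.2), `colPlus`, `colPlus_injective` (Thm. 7.3 i)), `isPlus_colPlus_z` (Thm. 6.3), `exact_plus`
((7.21) at `η`, sign `+`), `colMinus`, `colMinus_injective`, `isMinus_X_mul_colMinus_z`, `exact_minus`,
`isEulerSystemClass_z` (Thm. 6.3 "z is Kato's zeta element", Kato Ex. 13.3). Lane B's road
(`EulerSystemBound.kato_rational_of_zeta` / `kato_integral_of_zeta` / `etaKatoDivisibility_of_zeta_of_thm13_4`)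
consumes `isTorsion_fine`. Here:
* §1 `KatoSideCor72.isTorsion_fine_of_colemanFields_of_thm13_4` — FIELD-FREE: for the frame of hZ and
  ANY `z ∈ 𝐇¹_Γ(T_pW)`, ANY injective `Λ`-linear `Col : 𝐇¹_Γ → Λ` with `Col z` a quadratic-branch plus
  function, `z` a genuine Euler-system class, and (v) for `T_pW`: h134 ⟹ `X₀(W/ℚ_∞)` is `Λ`-torsion
  (`Col z = L_p⁺(V, η, X) ≠ 0` by Rohrlich — tree theorem `IsQuadraticBranchPlusLFunction.ne_zero_of_isNewformOf`
  — so `𝐇¹_Γ/Λz` is torsion, and Kato 13.4 (2) at the prime `(T)` forces `X₀` torsion: Literature theorem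
  `Kato2004.isTorsion_fineSelmerDual_of_thm13_4_of_injective`, same seat).
* §1 `KatoSideCor72.isTorsion_fine_of_zeta_of_thm13_4` — for `E : EtaColemanPoitouTateZetaData …` the
  conclusion of its field `isTorsion_fine`, proved from `E.z`, `E.colPlus`, `E.colPlus_injective`,
  `E.isPlus_colPlus_z`, `E.isEulerSystemClass_z` and h134 ONLY (the proof term does not mention
  `E.isTorsion_fine`).
* §2 `KatoSideCor72.nonempty_etaColemanPoitouTateZetaData_of_slimFields_of_thm13_4` — the package REBUILT
  from its ten other fields displayed as hypotheses + h134 + (v): the slim field set suffices on (v)-rows;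
  hence g0's Kato-completed package `EtaKatoColemanPoitouTateData` from the slim set
  (`nonempty_etaKatoColemanPoitouTateData_of_slimFields_of_thm13_4`).
* §3 the frame level BY NAME: `{hZ, h134}` ⟹ Cor. 7.2 at `η` on every frame of hZ with (v) for `W`
  (`fineSelmerDual_isTorsion_twist_of_zeta_of_thm13_4`); (v) DISCHARGED on the tower-onto rows
  (`…_of_onto`, `Kato2004/Condition1252QuadraticTwistProofs`) and on the non-CM rows (`…_of_not_hasCM`,
  `Kato2004/ConditionVOfNotHasCMProofs`, seat g5). In particular the conclusion of the load-bearing named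
  fact `Kato2004_fineSelmerDual_isTorsion` holds, from `{hZ, h134}`, for EVERY model `W` of the `p*`-twist
  of a globally minimal non-CM `V` with good reduction and `a_p = 0` at an odd `p`.

## Why (census line)

Trust base of crux 20445 after g7: `{hZ, h134, h12}` unchanged BY NAME, but inside hZ the printed
sentence Cor. 7.2 (= Kato 12.4 (1) on the fine part) is no longer an independent input on the crux's
rows — Kato's own order of proof (13.4 (2) ⟹ 12.4 (1)) runs in the kernel. NOT idle, recorded for the
planner/referee: `colPlus_injective` (Thm. 7.3 i)), which on the road is EQUIVALENT to
`rank_Λ 𝐇¹_Γ(T_pW) ≤ 1` (Kato Thm. 12.4 (2), Euler-system-borne; the tree proves it only from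
`rank_{ℤ_p} H¹(ℤ[1/p], T_pW) ≤ 1`, `Kato2004/IwasawaH1RankLeOneProofs`, a rank hypothesis the rank-free
crux does not carry) — a swap `Kobayashi 7.3 i) ↔ Kato 12.4 (2)`, not a reduction.

References: [Kobayashi2003] Cor. 7.2, Thm. 7.3 i) (p. 13), Thm. 6.3 (p. 11), Thm. 3.2 (p. 7);
[Kato2004Asterisque] Thm. 12.4 (p. 221), Thm. 13.4 (p. 226), (12.5.2) (p. 222); [RohrlichInventiones1984].
-/

noncomputable section

set_option linter.dupNamespace false

open scoped Classical

open CongruenceSubgroup Field WeierstrassCurve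
open Literature.NumberTheory.EllipticCurves
open Literature.NumberTheory.EllipticCurves.ModularForms
open Literature.NumberTheory.GaloisRepresentations
open Summit.BirchSwinnertonDyer.Rank1Residual.Additive hiding EtaSignedSelmerDualData

namespace Summit.BirchSwinnertonDyer.BirchSwinnertonDyer.Theorems

namespace KatoSideCor72

/-! ## §1 Cor. 7.2 at `η` from the Coleman fields and Kato Thm. 13.4 (2) -/

section Fields

variable {p : ℕ} [Fact p.Prime] {K₀ : Type} [Field K₀] [NumberField K₀]
  [(galRange (K := ℚ) K₀).Normal] {η : absoluteGaloisGroup ℚ →* ℤˣ}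
  {V : WeierstrassCurve ℚ} [V.IsElliptic] [V.IsGloballyMinimal] {N : ℕ} [NeZero N]
  {f : CuspForm (Gamma0 N) 2} {ϖ : ℚ} {κ : ZpExtension ℚ p} {γ : absoluteGaloisGroup ℚ}
  {W : WeierstrassCurve ℚ} [W.IsElliptic] [ContinuousSMul ℤ_[p] (W.tateModule p)]
  [Module.Free ℤ_[p] (W.tateModule p)] [Module.Finite ℤ_[p] (W.tateModule p)]
  {I : Kato2004.IwasawaH1Data W p κ γ} {FB : W.FineSelmerDualData κ γ}

/-- **Cor. 7.2 at `η`, FIELD-FREE, from Kato Thm. 13.4 (2).** On the frame of hZ (`p` odd, `V` good at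
`p` with newform `f` and period ratio `ϖ`, cyclotomic pin `(I, FB)` of a curve `W` — intended `W ≅ V^{(p*)}`):
for ANY `z ∈ 𝐇¹_Γ(T_pW)` that is a genuine Euler-system class, ANY injective `Λ`-linear `Col : 𝐇¹_Γ → Λ`
whose value at `z` is a quadratic-branch plus function `L_p⁺(V, η, X)`, and Kato's (v) for `T_pW`, the
named fact h134 implies `X₀(W/ℚ_∞) = FB.X` is `Λ`-torsion (`Col z ≠ 0` by Rohrlich, so `𝐇¹_Γ/Λz` is
torsion; then 13.4 (2) at `(T)`). CONDITIONAL on h134. [cite: Kobayashi2003, Cor. 7.2 and Thm. 7.3 i) (p. 13), Thm. 3.2 (p. 7)]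
[cite: Kato2004Asterisque, Thm. 13.4 (2) (p. 226)] -/
theorem isTorsion_fine_of_colemanFields_of_thm13_4
    (h134 : Kato2004.thm13_4_lengthAt_fineSelmerDual_le_of_isEulerSystemClass)
    (hp2 : p ≠ 2) (hgood : V.HasGoodReductionAtPrime p) (hf : IsNewformOf V f)
    (hϖ : if Even (p / 2) then (ϖ : ℝ) * V.realPeriodRat = plusPeriod f
      else (ϖ : ℝ) * V.imaginaryPeriodRat = minusPeriod f)
    (hκ : κ.IsCyclotomic) (hγ : κ.IsTopGenerator γ)
    (hv : ∃ σ : absoluteGaloisGroup ℚ,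
      (∀ (n : ℕ) (t : AlgebraicClosure ℚ), t ^ p ^ n = 1 → σ • t = t) ∧
        Module.finrank ℤ_[p]
          ((W.tateModule p) ⧸ LinearMap.range (W.galoisRepTate p σ - 1)) = 1)
    (z : I.H) (Col : I.H →ₗ[IwasawaAlgebra p] IwasawaAlgebra p) (hinj : Function.Injective Col)
    (hplus : IsQuadraticBranchPlusLFunction f p ϖ (Col z))
    (hES : Kato2004.IsEulerSystemClass W p κ γ I z) :
    Module.IsTorsion (IwasawaAlgebra p) FB.X :=
  Kato2004.isTorsion_fineSelmerDual_of_thm13_4_of_injective h134 hp2 hκ hγ I FB hES hv Col hinj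
    (IsQuadraticBranchPlusLFunction.ne_zero_of_isNewformOf hp2 hf hgood
      (EulerSystemBound.varpi_ne_zero hf hϖ) hplus)

/-- **The field `isTorsion_fine` of hZ is IDLE on (v)-rows.** For every `E : EtaColemanPoitouTateZetaData …`
its Cor. 7.2 conclusion `Module.IsTorsion Λ FB.X` follows from the fields `E.z`, `E.colPlus`,
`E.colPlus_injective`, `E.isPlus_colPlus_z`, `E.isEulerSystemClass_z` and h134 alone (this proof term
does not use `E.isTorsion_fine`). CONDITIONAL on h134. [cite: Kobayashi2003, Cor. 7.2 (p. 13)]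
[cite: Kato2004Asterisque, Thm. 13.4 (2) (p. 226) and Thm. 12.4 (1) (p. 221)] -/
theorem isTorsion_fine_of_zeta_of_thm13_4
    (E : Kobayashi2003.EtaColemanPoitouTateZetaData p K₀ η V f ϖ κ γ W I FB)
    (h134 : Kato2004.thm13_4_lengthAt_fineSelmerDual_le_of_isEulerSystemClass)
    (hp2 : p ≠ 2) (hgood : V.HasGoodReductionAtPrime p) (hf : IsNewformOf V f)
    (hϖ : if Even (p / 2) then (ϖ : ℝ) * V.realPeriodRat = plusPeriod f
      else (ϖ : ℝ) * V.imaginaryPeriodRat = minusPeriod f)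
    (hκ : κ.IsCyclotomic) (hγ : κ.IsTopGenerator γ)
    (hv : ∃ σ : absoluteGaloisGroup ℚ,
      (∀ (n : ℕ) (t : AlgebraicClosure ℚ), t ^ p ^ n = 1 → σ • t = t) ∧
        Module.finrank ℤ_[p]
          ((W.tateModule p) ⧸ LinearMap.range (W.galoisRepTate p σ - 1)) = 1) :
    Module.IsTorsion (IwasawaAlgebra p) FB.X :=
  isTorsion_fine_of_colemanFields_of_thm13_4 h134 hp2 hgood hf hϖ hκ hγ hv E.z E.colPlus
    E.colPlus_injective E.isPlus_colPlus_z E.isEulerSystemClass_z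

/-! ## §2 The package rebuilt from its slim field set -/

/-- **hZ's structure from its SLIM field set on (v)-rows.** Displaying the ten fields of
`EtaColemanPoitouTateZetaData` OTHER than `isTorsion_fine` as hypotheses, together with h134 and (v) for
`T_pW`, the full structure is inhabited (Cor. 7.2 supplied by §1). I.e. on the crux's rows the held
package could be typed without Cor. 7.2. CONDITIONAL on h134. [cite: Kobayashi2003, Thm. 6.2 (6.13)–(6.15), Thm. 6.3 (p. 11), Thm. 7.3 i) (7.21), Cor. 7.2 (p. 13)]
[cite: Kato2004Asterisque, Thm. 13.4 (2) (p. 226), Ex. 13.3 (p. 225)] -/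
theorem nonempty_etaColemanPoitouTateZetaData_of_slimFields_of_thm13_4
    (h134 : Kato2004.thm13_4_lengthAt_fineSelmerDual_le_of_isEulerSystemClass)
    (hp2 : p ≠ 2) (hgood : V.HasGoodReductionAtPrime p) (hf : IsNewformOf V f)
    (hϖ : if Even (p / 2) then (ϖ : ℝ) * V.realPeriodRat = plusPeriod f
      else (ϖ : ℝ) * V.imaginaryPeriodRat = minusPeriod f)
    (hκ : κ.IsCyclotomic) (hγ : κ.IsTopGenerator γ)
    (hv : ∃ σ : absoluteGaloisGroup ℚ,
      (∀ (n : ℕ) (t : AlgebraicClosure ℚ), t ^ p ^ n = 1 → σ • t = t) ∧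
        Module.finrank ℤ_[p]
          ((W.tateModule p) ⧸ LinearMap.range (W.galoisRepTate p σ - 1)) = 1)
    (z : I.H)
    (colPlus : I.H →ₗ[IwasawaAlgebra p] IwasawaAlgebra p) (colPlus_injective : Function.Injective colPlus)
    (isPlus_colPlus_z : IsQuadraticBranchPlusLFunction f p ϖ (colPlus z))
    (exact_plus : ∀ D : Kobayashi2003.EtaSignedSelmerDualData V κ K₀ ℚ_[p] η γ 1,
      ∃ (j : IwasawaAlgebra p →ₗ[IwasawaAlgebra p] D.X) (k : D.X →ₗ[IwasawaAlgebra p] FB.X),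
        Function.Exact colPlus j ∧ Function.Exact j k ∧ Function.Surjective k)
    (colMinus : I.H →ₗ[IwasawaAlgebra p] IwasawaAlgebra p)
    (colMinus_injective : Function.Injective colMinus)
    (isMinus_X_mul_colMinus_z : IsQuadraticBranchMinusLFunction f p ϖ (PowerSeries.X * colMinus z))
    (exact_minus : ∀ D : Kobayashi2003.EtaSignedSelmerDualData V κ K₀ ℚ_[p] η γ (-1),
      ∃ (j : IwasawaAlgebra p →ₗ[IwasawaAlgebra p] D.X) (k : D.X →ₗ[IwasawaAlgebra p] FB.X),
        Function.Exact colMinus j ∧ Function.Exact j k ∧ Function.Surjective k)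
    (isEulerSystemClass_z : Kato2004.IsEulerSystemClass W p κ γ I z) :
    Nonempty (Kobayashi2003.EtaColemanPoitouTateZetaData p K₀ η V f ϖ κ γ W I FB) :=
  ⟨{ z := z
     isTorsion_fine := isTorsion_fine_of_colemanFields_of_thm13_4 h134 hp2 hgood hf hϖ hκ hγ hv z colPlus
       colPlus_injective isPlus_colPlus_z isEulerSystemClass_z
     colPlus := colPlus
     colPlus_injective := colPlus_injective
     isPlus_colPlus_z := isPlus_colPlus_z
     exact_plus := exact_plus
     colMinus := colMinus
     colMinus_injective := colMinus_injective
     isMinus_X_mul_colMinus_z := isMinus_X_mul_colMinus_z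
     exact_minus := exact_minus
     isEulerSystemClass_z := isEulerSystemClass_z }⟩

/-- **g0's Kato-completed package `EtaKatoColemanPoitouTateData` from the slim field set**, on a frame
`C • W.quadraticTwist p* = V` with (v) for `T_pW`: §2 followed by lane B's
`EulerSystemBound.nonempty_etaKatoColemanPoitouTateData_of_zeta` (Kato's two clauses from h134). So the
road's entire input at `η` is: slim Coleman/Poitou–Tate fields + h134. CONDITIONAL on h134.
[cite: Kobayashi2003, Thm. 5.2 iii)–v) (p. 9), Thm. 6.2, 6.3 (p. 11), Thm. 7.3 i), Cor. 7.2 (p. 13)]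
[cite: Kato2004Asterisque, Thm. 13.4 (p. 226)] -/
theorem nonempty_etaKatoColemanPoitouTateData_of_slimFields_of_thm13_4
    (h134 : Kato2004.thm13_4_lengthAt_fineSelmerDual_le_of_isEulerSystemClass)
    (hp2 : p ≠ 2) (hgood : V.HasGoodReductionAtPrime p) (hf : IsNewformOf V f)
    (hϖ : if Even (p / 2) then (ϖ : ℝ) * V.realPeriodRat = plusPeriod f
      else (ϖ : ℝ) * V.imaginaryPeriodRat = minusPeriod f)
    (hκ : κ.IsCyclotomic) (hγ : κ.IsTopGenerator γ) (C : VariableChange ℚ)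
    (hWV : C • W.quadraticTwist (((-1 : ℚ) ^ (p / 2)) * p) = V)
    (hv : ∃ σ : absoluteGaloisGroup ℚ,
      (∀ (n : ℕ) (t : AlgebraicClosure ℚ), t ^ p ^ n = 1 → σ • t = t) ∧
        Module.finrank ℤ_[p]
          ((W.tateModule p) ⧸ LinearMap.range (W.galoisRepTate p σ - 1)) = 1)
    (z : I.H)
    (colPlus : I.H →ₗ[IwasawaAlgebra p] IwasawaAlgebra p) (colPlus_injective : Function.Injective colPlus)
    (isPlus_colPlus_z : IsQuadraticBranchPlusLFunction f p ϖ (colPlus z))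
    (exact_plus : ∀ D : Kobayashi2003.EtaSignedSelmerDualData V κ K₀ ℚ_[p] η γ 1,
      ∃ (j : IwasawaAlgebra p →ₗ[IwasawaAlgebra p] D.X) (k : D.X →ₗ[IwasawaAlgebra p] FB.X),
        Function.Exact colPlus j ∧ Function.Exact j k ∧ Function.Surjective k)
    (colMinus : I.H →ₗ[IwasawaAlgebra p] IwasawaAlgebra p)
    (colMinus_injective : Function.Injective colMinus)
    (isMinus_X_mul_colMinus_z : IsQuadraticBranchMinusLFunction f p ϖ (PowerSeries.X * colMinus z))
    (exact_minus : ∀ D : Kobayashi2003.EtaSignedSelmerDualData V κ K₀ ℚ_[p] η γ (-1),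
      ∃ (j : IwasawaAlgebra p →ₗ[IwasawaAlgebra p] D.X) (k : D.X →ₗ[IwasawaAlgebra p] FB.X),
        Function.Exact colMinus j ∧ Function.Exact j k ∧ Function.Surjective k)
    (isEulerSystemClass_z : Kato2004.IsEulerSystemClass W p κ γ I z) :
    Nonempty (Kobayashi2003.EtaKatoColemanPoitouTateData p K₀ η V f ϖ κ γ W I FB) := by
  obtain ⟨E⟩ := nonempty_etaColemanPoitouTateZetaData_of_slimFields_of_thm13_4 h134 hp2 hgood hf hϖ hκ
    hγ hv z colPlus colPlus_injective isPlus_colPlus_z exact_plus colMinus colMinus_injective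
    isMinus_X_mul_colMinus_z exact_minus isEulerSystemClass_z
  exact EulerSystemBound.nonempty_etaKatoColemanPoitouTateData_of_zeta E h134 hp2 hgood hf hϖ hκ hγ C
    hWV hv

end Fields

/-! ## §3 Frame level BY NAME: `{hZ, h134}` ⟹ Cor. 7.2 at `η` on (v)-rows; (v) discharged on the
tower-onto rows and on the non-CM rows -/

section ByName

variable {p : ℕ} [Fact p.Prime]

/-- **`{hZ, h134}` ⟹ Cor. 7.2 at `η`** on every frame of hZ whose twist model `W` satisfies Kato's (v):
for `p` odd, `K₀ = ℚ(μ_p)`, `η` the quadratic character, `V` globally minimal good at `p` with `a_p = 0`,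
its newform and period ratio, the cyclotomic pin, every model `W` of `V^{(p*)}` and every cyclotomic pin
`(I, FB)` of `W`: `X₀(W/ℚ_∞) = FB.X` is `Λ`-torsion. CONDITIONAL on the two named facts.
[cite: Kobayashi2003, Cor. 7.2 (p. 13), Thm. 6.3 (p. 11)] [cite: Kato2004Asterisque, Thm. 13.4 (2) (p. 226)] -/
theorem fineSelmerDual_isTorsion_twist_of_zeta_of_thm13_4
    (hZ : Kobayashi2003.thm62_63_73_etaColemanPoitouTate_zeta)
    (h134 : Kato2004.thm13_4_lengthAt_fineSelmerDual_le_of_isEulerSystemClass)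
    (K₀ : Type) [Field K₀] [NumberField K₀] [IsCyclotomicExtension {p} ℚ K₀]
    [(galRange (K := ℚ) K₀).Normal] (η : absoluteGaloisGroup ℚ →* ℤˣ)
    (hηK : ∀ σ ∈ galRange (K := ℚ) K₀, η σ = 1) (hη1 : η ≠ 1)
    (V : WeierstrassCurve ℚ) [V.IsElliptic] [V.IsGloballyMinimal] {N : ℕ} [NeZero N]
    {f : CuspForm (Gamma0 N) 2} (hp2 : p ≠ 2) (hgood : V.HasGoodReductionAtPrime p)
    (hap : V.frobeniusTrace p = 0) (hf : IsNewformOf V f) (ϖ : ℚ)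
    (hϖ : if Even (p / 2) then (ϖ : ℝ) * V.realPeriodRat = plusPeriod f
      else (ϖ : ℝ) * V.imaginaryPeriodRat = minusPeriod f)
    (κ : ZpExtension ℚ p) (γ : absoluteGaloisGroup ℚ) (hκ : κ.IsCyclotomic) (hγ : κ.IsTopGenerator γ)
    (hγK : γ ∈ galRange (K := ℚ) K₀) (hγc : IsCyclotomicVariable p γ)
    (W : WeierstrassCurve ℚ) [W.IsElliptic] [ContinuousSMul ℤ_[p] (W.tateModule p)]
    [Module.Free ℤ_[p] (W.tateModule p)] [Module.Finite ℤ_[p] (W.tateModule p)]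
    (C : VariableChange ℚ) (hC : C • W.quadraticTwist ((-1) ^ (p / 2) * p) = V)
    (hv : ∃ σ : absoluteGaloisGroup ℚ,
      (∀ (n : ℕ) (t : AlgebraicClosure ℚ), t ^ p ^ n = 1 → σ • t = t) ∧
        Module.finrank ℤ_[p]
          ((W.tateModule p) ⧸ LinearMap.range (W.galoisRepTate p σ - 1)) = 1)
    (I : Kato2004.IwasawaH1Data W p κ γ) (FB : W.FineSelmerDualData κ γ) :
    Module.IsTorsion (IwasawaAlgebra p) FB.X := by
  obtain ⟨E⟩ := hZ p K₀ η hηK hη1 V hp2 hgood hap hf ϖ hϖ κ γ hκ hγ hγK hγc W C hC I FB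
  exact isTorsion_fine_of_zeta_of_thm13_4 E h134 hp2 hgood hf hϖ hκ hγ hv

/-- **On the TOWER-ONTO rows (the domain of crux 20445) (v) is automatic** (`√p* ∈ ℚ(ζ_p)`: (12.5.2) for
`V` gives (12.5.2) for `W ≅ V^{(p*)}`, `Kato2004/Condition1252QuadraticTwistProofs`): `{hZ, h134}` ⟹
Cor. 7.2 at `η` with no further hypothesis. CONDITIONAL on the two named facts.
[cite: Kato2004Asterisque, (12.5.2) (p. 222) and Thm. 13.4 (p. 226)] [cite: Kobayashi2003, Cor. 7.2 (p. 13)] -/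
theorem fineSelmerDual_isTorsion_twist_of_zeta_of_thm13_4_of_onto
    (hZ : Kobayashi2003.thm62_63_73_etaColemanPoitouTate_zeta)
    (h134 : Kato2004.thm13_4_lengthAt_fineSelmerDual_le_of_isEulerSystemClass)
    (K₀ : Type) [Field K₀] [NumberField K₀] [IsCyclotomicExtension {p} ℚ K₀]
    [(galRange (K := ℚ) K₀).Normal] (η : absoluteGaloisGroup ℚ →* ℤˣ)
    (hηK : ∀ σ ∈ galRange (K := ℚ) K₀, η σ = 1) (hη1 : η ≠ 1)
    (V : WeierstrassCurve ℚ) [V.IsElliptic] [V.IsGloballyMinimal] {N : ℕ} [NeZero N]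
    {f : CuspForm (Gamma0 N) 2} (hp2 : p ≠ 2) (hgood : V.HasGoodReductionAtPrime p)
    (hap : V.frobeniusTrace p = 0) (hf : IsNewformOf V f) (ϖ : ℚ)
    (hϖ : if Even (p / 2) then (ϖ : ℝ) * V.realPeriodRat = plusPeriod f
      else (ϖ : ℝ) * V.imaginaryPeriodRat = minusPeriod f)
    (κ : ZpExtension ℚ p) (γ : absoluteGaloisGroup ℚ) (hκ : κ.IsCyclotomic) (hγ : κ.IsTopGenerator γ)
    (hγK : γ ∈ galRange (K := ℚ) K₀) (hγc : IsCyclotomicVariable p γ)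
    (W : WeierstrassCurve ℚ) [W.IsElliptic] [ContinuousSMul ℤ_[p] (W.tateModule p)]
    [Module.Free ℤ_[p] (W.tateModule p)] [Module.Finite ℤ_[p] (W.tateModule p)]
    (C : VariableChange ℚ) (hC : C • W.quadraticTwist ((-1) ^ (p / 2) * p) = V)
    (hsurj : ∀ m : ℕ, V.HasSurjectiveModNGaloisRep (p ^ m : ℕ))
    (I : Kato2004.IwasawaH1Data W p κ γ) (FB : W.FineSelmerDualData κ γ) :
    Module.IsTorsion (IwasawaAlgebra p) FB.X :=
  fineSelmerDual_isTorsion_twist_of_zeta_of_thm13_4 hZ h134 K₀ η hηK hη1 V hp2 hgood hap hf ϖ hϖ κ γ hκ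
    hγ hγK hγc W C hC
    (Kato2004.exists_finrank_coker_eq_one_of_smul_eq_quadraticTwist_primeStar_of_forall_hasSurjectiveModNGaloisRep
      hp2 C hC hsurj) I FB

/-- **On the NON-CM rows (v) is a theorem** (Kato's remark after Thm. 13.4: (v) fails only for CM;
kernel: `Kato2004.exists_finrank_coker_eq_one_twist_of_not_hasCM`, seat g5): `{hZ, h134}` ⟹ Cor. 7.2 at
`η` for every model `W` of the `p*`-twist of a globally minimal NON-CM `V` (good at `p`, `a_p = 0`, `p`
odd) — tower onto or not. CONDITIONAL on the two named facts.
[cite: Kato2004Asterisque, Thm. 13.4 (v) and the remark after it (p. 226)] [cite: Kobayashi2003, Cor. 7.2 (p. 13)] -/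
theorem fineSelmerDual_isTorsion_twist_of_zeta_of_thm13_4_of_not_hasCM
    (hZ : Kobayashi2003.thm62_63_73_etaColemanPoitouTate_zeta)
    (h134 : Kato2004.thm13_4_lengthAt_fineSelmerDual_le_of_isEulerSystemClass)
    (K₀ : Type) [Field K₀] [NumberField K₀] [IsCyclotomicExtension {p} ℚ K₀]
    [(galRange (K := ℚ) K₀).Normal] (η : absoluteGaloisGroup ℚ →* ℤˣ)
    (hηK : ∀ σ ∈ galRange (K := ℚ) K₀, η σ = 1) (hη1 : η ≠ 1)
    (V : WeierstrassCurve ℚ) [V.IsElliptic] [V.IsGloballyMinimal] (hV : ¬ V.HasCM) {N : ℕ} [NeZero N]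
    {f : CuspForm (Gamma0 N) 2} (hp2 : p ≠ 2) (hgood : V.HasGoodReductionAtPrime p)
    (hap : V.frobeniusTrace p = 0) (hf : IsNewformOf V f) (ϖ : ℚ)
    (hϖ : if Even (p / 2) then (ϖ : ℝ) * V.realPeriodRat = plusPeriod f
      else (ϖ : ℝ) * V.imaginaryPeriodRat = minusPeriod f)
    (κ : ZpExtension ℚ p) (γ : absoluteGaloisGroup ℚ) (hκ : κ.IsCyclotomic) (hγ : κ.IsTopGenerator γ)
    (hγK : γ ∈ galRange (K := ℚ) K₀) (hγc : IsCyclotomicVariable p γ)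
    (W : WeierstrassCurve ℚ) [W.IsElliptic] [ContinuousSMul ℤ_[p] (W.tateModule p)]
    [Module.Free ℤ_[p] (W.tateModule p)] [Module.Finite ℤ_[p] (W.tateModule p)]
    (C : VariableChange ℚ) (hC : C • W.quadraticTwist ((-1) ^ (p / 2) * p) = V)
    (I : Kato2004.IwasawaH1Data W p κ γ) (FB : W.FineSelmerDualData κ γ) :
    Module.IsTorsion (IwasawaAlgebra p) FB.X :=
  fineSelmerDual_isTorsion_twist_of_zeta_of_thm13_4 hZ h134 K₀ η hηK hη1 V hp2 hgood hap hf ϖ hϖ κ γ hκ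
    hγ hγK hγc W C hC (Kato2004.exists_finrank_coker_eq_one_twist_of_not_hasCM hp2 hV C hC) I FB

end ByName

end KatoSideCor72

end Summit.BirchSwinnertonDyer.BirchSwinnertonDyer.Theorems

end
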